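import Summits.BirchSwinnertonDyer.BirchSwinnertonDyer.Theorems.SignedLowerHalvesSmallImageMuZeroOneSignFinePivotOneSign
import Summits.BirchSwinnertonDyer.Rank1Residual.CoatesSujathaConjectureA
import HarnessLib

/-!
# Route `SignedLowerHalves` (K3), crux M `SmallImageMuZeroOneSign` (item stmt-BirchSwinnertonDyer-23600), line `birth_mu` v3 —
# crux M BY NAME from the tree's OBLIGATION NODE `CoatesSujathaConjectureA` (`@[conjecture]`, cell `bsd-littype`) and print

LEAD seat `cruxlead-stmt-BirchSwinnertonDyer-23600` gen 2 (cell `bsd-ssimc`; closer-shaped helper, `--supports stmt-BirchSwinnertonDyer-23600`).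
HONEST FRAMING: CONDITIONAL theorems.  `Summit.BirchSwinnertonDyer.Rank1Residual.FineSelmer.CoatesSujathaConjectureA` is an OPEN conjecture
(Coates–Sujatha 2005 §3 Conjecture A for every elliptic curve over every number field at every odd prime), consumed BY NAME as a
hypothesis — asserted for no curve; the three printed binders (Kurihara–Pollack 2007 ×2, p690488; Matar 2020 / Wingberg) are HELD
named facts without `_holds`.  Crux M, crux 4 and BSD are NOT proved by this file.  What it records, in the kernel: crux M is implied
by ONE EXISTING NAMED conjecture node plus print (and, by `SmallImageFinePivot.fineMuZeroAt_of_oneSignMuZero`, implies that node's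
restriction to its own domain in `μ`-form) — the line's open stub `stub_conjA_ns_ge5` is that node restricted to the small-image
supersingular X7 class at `p ≥ 5`.

* `conjAAt_of_coatesSujathaConjectureA` — the node specialised to `K = ℚ` is `Rank1Residual.ConjAAt W p` (same spelling).
* `smallImageMuZeroOneSign_of_facts_of_coatesSujathaConjectureA` — crux M BY NAME ⟸ the 3 prints ∧ the node.
* `stub_conjA_ns_ge5_of_coatesSujathaConjectureA` — the registered open stub of `birth_mu` v3 ⟸ the node.

References: [CoatesSujatha2005] §3 Conjecture A; [KuriharaPollack2007] §1.2, §3 p. 328; [Matar2020] Thm. 1.1; [LeiSujatha2021] §1.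
-/

set_option autoImplicit false
set_option linter.dupNamespace false

noncomputable section

open scoped Classical

namespace Summit.BirchSwinnertonDyer.BirchSwinnertonDyer.Theorems.SmallImageFinePivot

open Literature.NumberTheory.EllipticCurves Literature.NumberTheory.EllipticCurves.Rank1Residual
  Summit.BirchSwinnertonDyer.Rank1Residual.FineSelmer

/-- The obligation node `CoatesSujathaConjectureA` (all number fields) specialised to `K = ℚ` is the per-pair predicate
`ConjAAt W p` (identical spelling of the body). [cite: CoatesSujatha2005, §3 Conjecture A] -/
theorem conjAAt_of_coatesSujathaConjectureA (hA : CoatesSujathaConjectureA) (W : WeierstrassCurve ℚ) [W.IsElliptic]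
    (p : ℕ) [Fact p.Prime] (hp : p ≠ 2) : ConjAAt W p :=
  fun κ hκ ↦ hA ℚ W p hp κ hκ

/-- **Crux M `SmallImageMuZeroOneSign` BY NAME ⟸ print ∧ the obligation node `CoatesSujathaConjectureA`.**
[cite: CoatesSujatha2005, §3 Conjecture A] [cite: KuriharaPollack2007, §1.2 Prop. 1.2, §3 p. 328] [cite: Matar2020, Thm. 1.1] -/
theorem smallImageMuZeroOneSign_of_facts_of_coatesSujathaConjectureA
    (hKP : kuriharaPollack2007_selmerDual_extension_of_fineDual) (hKo : signedSelmerInf_sub_fineSelmer_of_loc)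
    (hMa : matar2020_thm11_selmerDualTorsion_pseudoIso_fineSelmerDual) (hA : CoatesSujathaConjectureA) :
    Summit.BirchSwinnertonDyer.BirchSwinnertonDyer.Theses.SignedLowerHalves.SmallImageMuZeroOneSign :=
  smallImageMuZeroOneSign_of_facts_of_conjA hKP hKo hMa
    fun W _ _ p _ hp _ _ _ _ ↦ conjAAt_of_coatesSujathaConjectureA hA W p hp

/-- **The registered OPEN stub `stub_conjA_ns_ge5` of line `birth_mu` v3 ⟸ the obligation node** (verbatim stub signature as the
conclusion). [cite: CoatesSujatha2005, §3 Conjecture A] -/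
theorem stub_conjA_ns_ge5_of_coatesSujathaConjectureA (hA : CoatesSujathaConjectureA) :
    ∀ (W : WeierstrassCurve ℚ) [W.IsElliptic] [W.IsGloballyMinimal] (p : ℕ) [Fact p.Prime],
      5 ≤ p → ClassX7 W p → ¬ W.HasCM → W.frobeniusTrace p = 0 → ¬ Surj W p → ConjAAt W p := by
  intro W _ _ p _ hp5 _ _ _ _
  have hp : p ≠ 2 := by rintro rfl; exact absurd hp5 (by decide)
  exact conjAAt_of_coatesSujathaConjectureA hA W p hp

end Summit.BirchSwinnertonDyer.BirchSwinnertonDyer.Theorems.SmallImageFinePivot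

end
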